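import Summits.AnomalousDissipation.AnomalousDissipation.Theorems.DopplerClockQuadratureStressFloorClockTermBound
import Summits.AnomalousDissipation.AnomalousDissipation.Theorems.DopplerClockDopplerWorkIdentity
import Summits.AnomalousDissipation.AnomalousDissipation.Theorems.DopplerClockCruxesGiveTarget
import Summits.AnomalousDissipation.AnomalousDissipation.Theorems.DopplerClockForceAdmissible
import Summits.AnomalousDissipation.AnomalousDissipation.Theorems.DopplerClockQuadratureStressFloorPatternTransportFacts

/-!
# Route DopplerClock (AnomalousDissipation) — crux `QuadratureStressFloor` (stmt-AnomalousDissipation-18129),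
# line `laminar-burst-shadowing` (payload slug `Sketch`): the ENERGY-FREE BRIDGE and its converse

With the energy-free clock-term bound (`EnergyFreeBridge.abs_longTimeAvg_inner_le`,
`Theorems/DopplerClockQuadratureStressFloorClockTermBound.lean`) the ν-uniform energy cap of the landed bridges is
unnecessary, and the crux becomes EQUIVALENT to an energy-free injection floor:

* `dopplerClock_quadratureStressFloor_of_energyFreeInjectionFloor` (registered stub
  `stub_bridgeEnergyFreeInjectionFloor`, restated verbatim at the end) — ANY vanishing-viscosity family of global
  Leray–Hopf drift-`V` solutions of the Doppler force with PER-`j` energy bounds, no leakage and an injection floor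
  `η ≤ Λ⟨(f,u_j)⟩` in one generalized limit gives the crux: with `δ := κ²/(4π²c)`, `c = 2πnV/F` (pattern size
  `K = 1`), the identity and the clock-term bound give `−Λ⟨T_s(w_j)⟩ ≥ cη/2 − ν_j κ⁴/(8π²c) ≥ cη/4` along the tail
  `j ↦ j + J`.
* `dopplerClock_injectionFloor_of_quadratureStressFloor` — **the converse**: the crux implies such a family (same
  design, same `Λ`, a tail of the same family): `ε₀ ≤ −Λ⟨T_s⟩ ≤ (c + κ²/(8π²)) Λ⟨(f,u_j)⟩ + ν_jκ²/2` (`δ := 1`).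
* `dopplerClock_quadratureStressFloor_iff_energyFreeInjectionFloor` — hence `QuadratureStressFloor` is EQUIVALENT to
  the energy-free, no-leak, pinned-momentum injection floor in one generalized limit: the kernel-precise content of C1
  (the strategist's census B2/B3 read "energies up to o(ν⁻²) are tolerated"; in fact every energy is, and the
  ν-uniform-energy reading `NoLeakInjectionFloorFamily` of `stub_bridgeNoLeakInjectionFloor` is superseded).

No new definitions (Doering–Foias 2002 §2; Foias–Manley–Rosa–Temam 2001 Ch. IV §1, §3.1).
-/

noncomputable section

-- `Summit.<Summit>.<Problem>` is the tree's mandated summit-side namespace (CONVENTIONS §2); for this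
-- single-conjunct summit the two coincide, so the duplicate is deliberate.
set_option linter.dupNamespace false

open MeasureTheory Set Filter Topology
open scoped InnerProductSpace RealInnerProductSpace

namespace Summit.AnomalousDissipation.AnomalousDissipation.Theorems

open Literature.Analysis.FunctionSpaces Literature.Analysis.FunctionSpaces.Torus
open Literature.Analysis.FluidPDE Literature.Analysis.FluidPDE.Torus

namespace EnergyFreeBridge

/-! ### The quadrature streak pattern `Ψ_s = sin(2πm x₁) sin(2πn x₂) e₀`: size and mean -/

/-- `‖Ψ_s x‖ ≤ 1`. [folklore] -/
theorem norm_pattern_le_one (m n : ℕ) (x : UnitAddTorus (Fin 3)) :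
    ‖((UnitAddTorus.mFourier (Pi.single (1 : Fin 3) (m : ℤ)) x).im *
        (UnitAddTorus.mFourier (Pi.single (2 : Fin 3) (n : ℤ)) x).im) •
        EuclideanSpace.single (0 : Fin 3) (1 : ℝ)‖ ≤ 1 := by
  rw [PatternTransport.norm_smul_single_zero_one, abs_mul]
  exact (mul_le_mul (PatternTransport.abs_im_mFourier_le_one _ _)
    (PatternTransport.abs_im_mFourier_le_one _ _) (abs_nonneg _) zero_le_one).trans_eq (one_mul 1)

/-- `∫ Ψ_s = 0` for `m ≥ 1` (`Ψ_s` is half the sum of two cosine Stokes modes at the non-zero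
frequencies `(0, m, ∓n)`). [folklore] -/
theorem pattern_hasZeroMean {m : ℕ} (hm : 0 < m) (n : ℕ) :
    HasZeroMean (fun y : UnitAddTorus (Fin 3) =>
      ((UnitAddTorus.mFourier (Pi.single (1 : Fin 3) (m : ℤ)) y).im *
        (UnitAddTorus.mFourier (Pi.single (2 : Fin 3) (n : ℤ)) y).im) •
        EuclideanSpace.single (0 : Fin 3) (1 : ℝ)) := by
  rw [DopplerWork.pattern_eq_stokesModes]
  have hm0 : m ≠ 0 := hm.ne'
  have hk1 : (Pi.single (1 : Fin 3) (m : ℤ) : Fin 3 → ℤ) - Pi.single (2 : Fin 3) (n : ℤ) ≠ 0 := by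
    intro h
    have h1 := congr_fun h 1
    simp at h1
    exact hm0 (by exact_mod_cast h1)
  have hk2 : (Pi.single (1 : Fin 3) (m : ℤ) : Fin 3 → ℤ) + Pi.single (2 : Fin 3) (n : ℤ) ≠ 0 := by
    intro h
    have h1 := congr_fun h 1
    simp at h1
    exact hm0 (by exact_mod_cast h1)
  have h1 := hasZeroMean_stokesMode hk1 (EuclideanSpace.single (0 : Fin 3) (1 : ℝ)) true
  have h2 := hasZeroMean_stokesMode hk2 (-EuclideanSpace.single (0 : Fin 3) (1 : ℝ)) true
  unfold HasZeroMean at h1 h2 ⊢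
  have i1 : Integrable (⇑(stokesMode ((Pi.single (1 : Fin 3) (m : ℤ) : Fin 3 → ℤ) - Pi.single (2 : Fin 3) (n : ℤ))
      (EuclideanSpace.single (0 : Fin 3) (1 : ℝ)) true)) (volume : Measure (UnitAddTorus (Fin 3))) :=
    (stokesMode _ _ _).continuous.integrable_unitAddTorus
  have i2 : Integrable (⇑(stokesMode ((Pi.single (1 : Fin 3) (m : ℤ) : Fin 3 → ℤ) + Pi.single (2 : Fin 3) (n : ℤ))
      (-EuclideanSpace.single (0 : Fin 3) (1 : ℝ)) true)) (volume : Measure (UnitAddTorus (Fin 3))) :=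
    (stokesMode _ _ _).continuous.integrable_unitAddTorus
  rw [integral_smul, integral_add i1 i2, h1, h2, add_zero, smul_zero]

/-! ### Tail arithmetic -/

/-- **Floor arithmetic (energy-free).** If `−T = cP − νκB`, `η ≤ P`, the clock bound
`B ≤ δ/2 + P/(8π²νδ)` holds at `δ = κ/(4π²c)`, and `ν κ²/(8π²c) ≤ cη/4`, then `cη/4 ≤ −T`. [folklore] -/
theorem floor_arith {c ν κ η B T P : ℝ} (hc : 0 < c) (hν : 0 < ν) (hκ : 0 < κ)
    (hid : -T = c * P - ν * κ * B) (hP : η ≤ P)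
    (hB : B ≤ κ / (4 * Real.pi ^ 2 * c) / 2 +
      1 ^ 2 / (8 * Real.pi ^ 2 * ν * (κ / (4 * Real.pi ^ 2 * c))) * P)
    (hsmall : ν * (κ ^ 2 / (8 * Real.pi ^ 2 * c)) ≤ c * η / 4) : c * η / 4 ≤ -T := by
  have hpi : 0 < Real.pi ^ 2 := by positivity
  have hB' : ν * κ * B ≤ ν * (κ ^ 2 / (8 * Real.pi ^ 2 * c)) + c / 2 * P := by
    have h1 : ν * κ * B ≤ ν * κ * (κ / (4 * Real.pi ^ 2 * c) / 2 +
        1 ^ 2 / (8 * Real.pi ^ 2 * ν * (κ / (4 * Real.pi ^ 2 * c))) * P) :=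
      mul_le_mul_of_nonneg_left hB (by positivity)
    have h2 : ν * κ * (κ / (4 * Real.pi ^ 2 * c) / 2 +
        1 ^ 2 / (8 * Real.pi ^ 2 * ν * (κ / (4 * Real.pi ^ 2 * c))) * P) =
        ν * (κ ^ 2 / (8 * Real.pi ^ 2 * c)) + c / 2 * P := by
      field_simp
      ring
    linarith
  rw [hid]
  nlinarith [mul_le_mul_of_nonneg_left hP hc.le]

/-- **Converse arithmetic.** If `−T = cP − νκB`, `ε₀ ≤ −T`, the clock bound `|B| ≤ ½ + P/(8π²ν)`
(`δ = 1`) holds and `νκ ≤ ε₀`, then `ε₀ / (2(c + κ/(8π²))) ≤ P`. [folklore] -/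
theorem converse_arith {c ν κ ε₀ B T P : ℝ} (hc : 0 < c) (hν : 0 < ν) (hκ : 0 ≤ κ)
    (hid : -T = c * P - ν * κ * B) (hfl : ε₀ ≤ -T)
    (hB : |B| ≤ 1 / 2 + 1 ^ 2 / (8 * Real.pi ^ 2 * ν * 1) * P) (hsmall : ν * κ ≤ ε₀) :
    ε₀ / (2 * (c + κ / (8 * Real.pi ^ 2))) ≤ P := by
  have hpi : 0 < Real.pi ^ 2 := by positivity
  have hBlo : -B ≤ 1 / 2 + 1 ^ 2 / (8 * Real.pi ^ 2 * ν * 1) * P := (neg_le_abs B).trans hB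
  have h1 : ν * κ * (-B) ≤ ν * κ * (1 / 2 + 1 ^ 2 / (8 * Real.pi ^ 2 * ν * 1) * P) :=
    mul_le_mul_of_nonneg_left hBlo (mul_nonneg hν.le hκ)
  have h2 : ν * κ * (1 / 2 + 1 ^ 2 / (8 * Real.pi ^ 2 * ν * 1) * P) =
      ν * κ / 2 + κ / (8 * Real.pi ^ 2) * P := by
    field_simp
  have h3 : ε₀ / 2 ≤ (c + κ / (8 * Real.pi ^ 2)) * P := by nlinarith
  rw [div_le_iff₀ (by positivity)]
  nlinarith

end EnergyFreeBridge

open EnergyFreeBridge in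
/-- **The converse of the energy-free bridge: the crux gives an energy-free no-leak injection-floor
family.** If `QuadratureStressFloor` holds with design `(F,V,m,n)`, generalized limit `Λ` and family
`(ν_j, u₀ⱼ, u_j)`, then along a tail `j ↦ j + J` of the SAME family the mean injection has a positive floor
in the same `Λ`: `ε₀ ≤ −Λ⟨T_s(w_j)⟩ = cΛ⟨(f,u_j)⟩ − ν_jκ²Λ⟨(Ψ_s,u_j)⟩ ≤ (c + κ²/(8π²))Λ⟨(f,u_j)⟩ + ν_jκ²/2`
(identity 18133 and the clock-term bound at `δ = 1`), so `Λ⟨(f,u_j)⟩ ≥ ε₀/(2(c + κ²/(8π²)))` once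
`ν_jκ² ≤ ε₀`. [folklore] -/
theorem dopplerClock_injectionFloor_of_quadratureStressFloor :
    Summit.AnomalousDissipation.AnomalousDissipation.Theses.DopplerClock.QuadratureStressFloor →
    (∃ (F V : ℝ) (m n : ℕ), 0 < F ∧ 0 < V ∧ 0 < m ∧ 0 < n ∧
      ∃ (Λ : Literature.Analysis.FluidPDE.GeneralizedLimit),
      ∃ (ν : ℕ → ℝ) (u₀ : ℕ → UnitAddTorus (Fin 3) → EuclideanSpace ℝ (Fin 3))
        (u : ℕ → ℝ → UnitAddTorus (Fin 3) → EuclideanSpace ℝ (Fin 3)),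
        (∀ j, 0 < ν j) ∧ Filter.Tendsto ν Filter.atTop (nhds 0) ∧
        (∀ j, Literature.Analysis.FluidPDE.Torus.IsGlobalLerayHopf (ν j) (fun _ => (fun (x : UnitAddTorus (Fin 3)) => (F * (UnitAddTorus.mFourier (Pi.single (1 : Fin 3) (m : ℤ)) x).im * (UnitAddTorus.mFourier (Pi.single (2 : Fin 3) (n : ℤ)) x).re) • EuclideanSpace.single (0 : Fin 3) (1 : ℝ))) (u₀ j) (u j)) ∧
        (∀ j, ∫ x, u₀ j x = V • EuclideanSpace.single (2 : Fin 3) (1 : ℝ)) ∧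
        (∀ j, ∃ C : ℝ, ∀ t : ℝ, 0 ≤ t → Literature.Analysis.FunctionSpaces.Torus.kineticEnergy (u j t) ≤ C) ∧
        (∀ j, Literature.Analysis.FluidPDE.longTimeAvgSup (fun t => ∫ x, inner ℝ ((F * (UnitAddTorus.mFourier (Pi.single (1 : Fin 3) (m : ℤ)) x).im * (UnitAddTorus.mFourier (Pi.single (2 : Fin 3) (n : ℤ)) x).re) • EuclideanSpace.single (0 : Fin 3) (1 : ℝ)) (u j t x)) ≤
          Literature.Analysis.FluidPDE.meanDissipation (ν j) (u j)) ∧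
        ∃ η : ℝ, 0 < η ∧ ∀ j, η ≤ Λ.longTimeAvg (fun t => ∫ x, inner ℝ ((F * (UnitAddTorus.mFourier (Pi.single (1 : Fin 3) (m : ℤ)) x).im * (UnitAddTorus.mFourier (Pi.single (2 : Fin 3) (n : ℤ)) x).re) • EuclideanSpace.single (0 : Fin 3) (1 : ℝ)) (u j t x))) := by
  rintro ⟨F, V, m, n, hF, hV, hm, hn, Λ, ν, u₀, u, hν, hν0, hLH, hmom, hsup, hnoleak, ε₀, hε₀, hfloor⟩
  -- abbreviations for the force and the quadrature pattern
  set f : UnitAddTorus (Fin 3) → EuclideanSpace ℝ (Fin 3) := fun x =>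
    (F * (UnitAddTorus.mFourier (Pi.single (1 : Fin 3) (m : ℤ)) x).im *
      (UnitAddTorus.mFourier (Pi.single (2 : Fin 3) (n : ℤ)) x).re) •
      EuclideanSpace.single (0 : Fin 3) (1 : ℝ) with hfdef
  set Ψ : UnitAddTorus (Fin 3) → EuclideanSpace ℝ (Fin 3) := fun y =>
    ((UnitAddTorus.mFourier (Pi.single (1 : Fin 3) (m : ℤ)) y).im *
      (UnitAddTorus.mFourier (Pi.single (2 : Fin 3) (n : ℤ)) y).im) •
      EuclideanSpace.single (0 : Fin 3) (1 : ℝ) with hΨdef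
  have hfS : IsSmooth f := dopplerClock_isSmooth_im_mul_re_smul F _ _ _
  have hf0 : HasZeroMean f := dopplerForce_hasZeroMean F _ _
  have hΨc : Continuous Ψ := (dopplerClock_isSmooth_im_mul_im_smul _ _ _).continuous
  have hΨ0 : HasZeroMean Ψ := pattern_hasZeroMean hm n
  have hΨ1 : ∀ x, ‖Ψ x‖ ≤ 1 := norm_pattern_le_one m n
  -- constants
  have hn' : (0 : ℝ) < (n : ℝ) := Nat.cast_pos.2 hn
  set κ2 : ℝ := (2 * Real.pi) ^ 2 * ((m : ℝ) ^ 2 + (n : ℝ) ^ 2) with hκ2def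
  have hκ2 : 0 ≤ κ2 := by rw [hκ2def]; positivity
  set c : ℝ := V * (2 * Real.pi * n) / F with hcdef
  have hc : 0 < c := by rw [hcdef]; positivity
  -- the identity, solved for `−Λ⟨T_s⟩`
  have hid : ∀ j, -Λ.longTimeAvg (fun t => ∫ x, ⟪u j t x - V • EuclideanSpace.single (2 : Fin 3) (1 : ℝ),
        convect (fun y => u j t y - V • EuclideanSpace.single (2 : Fin 3) (1 : ℝ)) Ψ x⟫) =
      c * Λ.longTimeAvg (fun t => ∫ x, ⟪f x, u j t x⟫) -
        ν j * κ2 * Λ.longTimeAvg (fun t => ∫ x, ⟪Ψ x, u j t x⟫) := by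
    intro j
    have h := dopplerWorkIdentity_proof Λ F V (ν j) m n (u₀ j) (u j) hV (hν j) hn (hLH j) (hmom j) (hsup j)
    have hFne : F ≠ 0 := hF.ne'
    have hVne : V * (2 * Real.pi * n) ≠ 0 := by positivity
    rw [hcdef, h]
    field_simp
    ring
  -- the clock-term bound at `δ = 1`
  have hB : ∀ j, |Λ.longTimeAvg (fun t => ∫ x, ⟪Ψ x, u j t x⟫)| ≤
      1 / 2 + 1 ^ 2 / (8 * Real.pi ^ 2 * ν j * 1) * Λ.longTimeAvg (fun t => ∫ x, ⟪f x, u j t x⟫) :=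
    fun j => abs_longTimeAvg_inner_le Λ (hν j) hfS hf0 (hLH j) (hsup j) hΨc hΨ0 hΨ1 one_pos
  -- choose the tail: `ν_j κ² ≤ ε₀` for `j ≥ J`
  obtain ⟨J, hJ⟩ : ∃ J : ℕ, ∀ j ≥ J, ν j ≤ ε₀ / (κ2 + 1) := by
    have hpos : 0 < ε₀ / (κ2 + 1) := by positivity
    exact eventually_atTop.1 ((hν0.eventually (ge_mem_nhds hpos)).mono fun j hj => hj)
  have hinjTail : ∀ j, J ≤ j →
      ε₀ / (2 * (c + κ2 / (8 * Real.pi ^ 2))) ≤ Λ.longTimeAvg (fun t => ∫ x, ⟪f x, u j t x⟫) := by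
    intro j hj
    have hsmall : ν j * κ2 ≤ ε₀ := by
      have h1 : ν j * (κ2 + 1) ≤ ε₀ := by
        have := hJ j hj
        rwa [le_div_iff₀ (by positivity)] at this
      nlinarith [(hν j).le, h1]
    exact converse_arith hc (hν j) hκ2 (hid j) (hfloor j) (hB j) hsmall
  -- assemble along the reindexed tail `j ↦ j + J`
  refine ⟨F, V, m, n, hF, hV, hm, hn, Λ, fun j => ν (j + J), fun j => u₀ (j + J), fun j => u (j + J),
    fun j => hν _, hν0.comp (tendsto_add_atTop_nat J), fun j => hLH _, fun j => hmom _, fun j => hsup _,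
    fun j => hnoleak _, ε₀ / (2 * (c + κ2 / (8 * Real.pi ^ 2))), by positivity, fun j => ?_⟩
  exact hinjTail (j + J) (Nat.le_add_left J j)

open EnergyFreeBridge in
/-- **The ENERGY-FREE bridge** (crux `QuadratureStressFloor`, stmt-AnomalousDissipation-18129; registered on the
crux item as stub `stub_bridgeEnergyFreeInjectionFloor` of line `Sketch`, restated verbatim at the end of this file). ANY vanishing-viscosity family of global Leray–Hopf
drift-`V` solutions of the Doppler force with PER-`j` sup-in-time energy bounds (exactly the crux's own clause),
no leakage and an injection floor `η ≤ Λ⟨(f,u_j)⟩` in one generalized limit gives the crux (stated as its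
UNFOLDED body, definitionally `…Theses.DopplerClock.QuadratureStressFloor`). Proof: identity 18133 solved for
`−Λ⟨T_s⟩`, the clock-term bound at `δ = κ²/(4π²c)` (`c = 2πnV/F`, pattern size `K = 1`), giving
`−Λ⟨T_s(w_j)⟩ ≥ cη/2 − ν_jκ⁴/(8π²c) ≥ cη/4 =: ε₀` along the tail `j ↦ j + J`. Supersedes
`stub_bridgeNoLeakInjectionFloor` (ν-uniform cap). [folklore] -/
theorem dopplerClock_quadratureStressFloor_of_energyFreeInjectionFloor :
    (∃ (F V : ℝ) (m n : ℕ), 0 < F ∧ 0 < V ∧ 0 < m ∧ 0 < n ∧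
      ∃ (Λ : Literature.Analysis.FluidPDE.GeneralizedLimit),
      ∃ (ν : ℕ → ℝ) (u₀ : ℕ → UnitAddTorus (Fin 3) → EuclideanSpace ℝ (Fin 3))
        (u : ℕ → ℝ → UnitAddTorus (Fin 3) → EuclideanSpace ℝ (Fin 3)),
        (∀ j, 0 < ν j) ∧ Filter.Tendsto ν Filter.atTop (nhds 0) ∧
        (∀ j, Literature.Analysis.FluidPDE.Torus.IsGlobalLerayHopf (ν j) (fun _ => (fun (x : UnitAddTorus (Fin 3)) => (F * (UnitAddTorus.mFourier (Pi.single (1 : Fin 3) (m : ℤ)) x).im * (UnitAddTorus.mFourier (Pi.single (2 : Fin 3) (n : ℤ)) x).re) • EuclideanSpace.single (0 : Fin 3) (1 : ℝ))) (u₀ j) (u j)) ∧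
        (∀ j, ∫ x, u₀ j x = V • EuclideanSpace.single (2 : Fin 3) (1 : ℝ)) ∧
        (∀ j, ∃ C : ℝ, ∀ t : ℝ, 0 ≤ t → Literature.Analysis.FunctionSpaces.Torus.kineticEnergy (u j t) ≤ C) ∧
        (∀ j, Literature.Analysis.FluidPDE.longTimeAvgSup (fun t => ∫ x, inner ℝ ((F * (UnitAddTorus.mFourier (Pi.single (1 : Fin 3) (m : ℤ)) x).im * (UnitAddTorus.mFourier (Pi.single (2 : Fin 3) (n : ℤ)) x).re) • EuclideanSpace.single (0 : Fin 3) (1 : ℝ)) (u j t x)) ≤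
          Literature.Analysis.FluidPDE.meanDissipation (ν j) (u j)) ∧
        ∃ η : ℝ, 0 < η ∧ ∀ j, η ≤ Λ.longTimeAvg (fun t => ∫ x, inner ℝ ((F * (UnitAddTorus.mFourier (Pi.single (1 : Fin 3) (m : ℤ)) x).im * (UnitAddTorus.mFourier (Pi.single (2 : Fin 3) (n : ℤ)) x).re) • EuclideanSpace.single (0 : Fin 3) (1 : ℝ)) (u j t x))) →
    (∃ (F V : ℝ) (m n : ℕ), 0 < F ∧ 0 < V ∧ 0 < m ∧ 0 < n ∧ ∃ (Λ : Literature.Analysis.FluidPDE.GeneralizedLimit), ∃ (ν : ℕ → ℝ) (u₀ : ℕ → UnitAddTorus (Fin 3) → EuclideanSpace ℝ (Fin 3)) (u : ℕ → ℝ → UnitAddTorus (Fin 3) → EuclideanSpace ℝ (Fin 3)), (∀ j, 0 < ν j) ∧ Filter.Tendsto ν Filter.atTop (nhds 0) ∧ (∀ j, Literature.Analysis.FluidPDE.Torus.IsGlobalLerayHopf (ν j) (fun _ => (fun (x : UnitAddTorus (Fin 3)) => (F * (UnitAddTorus.mFourier (Pi.single (1 : Fin 3) (m : ℤ)) x).im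 * (UnitAddTorus.mFourier (Pi.single (2 : Fin 3) (n : ℤ)) x).re) • EuclideanSpace.single (0 : Fin 3) (1 : ℝ))) (u₀ j) (u j)) ∧ (∀ j, ∫ x, u₀ j x = V • EuclideanSpace.single (2 : Fin 3) (1 : ℝ)) ∧ (∀ j, ∃ C : ℝ, ∀ t : ℝ, 0 ≤ t → Literature.Analysis.FunctionSpaces.Torus.kineticEnergy (u j t) ≤ C) ∧ (∀ j, Literature.Analysis.FluidPDE.longTimeAvgSup (fun t => ∫ x, inner ℝ ((F * (UnitAddTorus.mFourier (Pi.single (1 : Fin 3) (m : ℤ)) x).im * (UnitAddTorus.mFourier (Pi.single (2 : Fin 3) (n : ℤ)) x).re) • EuclideanSpace.single (0 : Fin 3) (1 : ℝ)) (u j t x)) ≤ Literature.Analysis.FluidPDE.meanDissipation (ν j) (u j)) ∧ ∃ ε₀ : ℝ, 0 < ε₀ ∧ ∀ j, ε₀ ≤ -Λ.longTimeAvg (fun t => ∫ x, inner ℝ (u j t x - V • EuclideanSpace.single (2 : Fin 3) (1 : ℝ)) (Literature.Analysis.FunctionSpaces.Torus.convect (fun y => u j t y - V • EuclideanSpace.single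 (2 : Fin 3) (1 : ℝ)) (fun (y : UnitAddTorus (Fin 3)) => ((UnitAddTorus.mFourier (Pi.single (1 : Fin 3) (m : ℤ)) y).im * (UnitAddTorus.mFourier (Pi.single (2 : Fin 3) (n : ℤ)) y).im) • EuclideanSpace.single (0 : Fin 3) (1 : ℝ)) x))) := by
  rintro ⟨F, V, m, n, hF, hV, hm, hn, Λ, ν, u₀, u, hν, hν0, hLH, hmom, hsup, hnoleak, η, hη, hinj⟩
  -- abbreviations for the force and the quadrature pattern
  set f : UnitAddTorus (Fin 3) → EuclideanSpace ℝ (Fin 3) := fun x =>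
    (F * (UnitAddTorus.mFourier (Pi.single (1 : Fin 3) (m : ℤ)) x).im *
      (UnitAddTorus.mFourier (Pi.single (2 : Fin 3) (n : ℤ)) x).re) •
      EuclideanSpace.single (0 : Fin 3) (1 : ℝ) with hfdef
  set Ψ : UnitAddTorus (Fin 3) → EuclideanSpace ℝ (Fin 3) := fun y =>
    ((UnitAddTorus.mFourier (Pi.single (1 : Fin 3) (m : ℤ)) y).im *
      (UnitAddTorus.mFourier (Pi.single (2 : Fin 3) (n : ℤ)) y).im) •
      EuclideanSpace.single (0 : Fin 3) (1 : ℝ) with hΨdef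
  have hfS : IsSmooth f := dopplerClock_isSmooth_im_mul_re_smul F _ _ _
  have hf0 : HasZeroMean f := dopplerForce_hasZeroMean F _ _
  have hΨc : Continuous Ψ := (dopplerClock_isSmooth_im_mul_im_smul _ _ _).continuous
  have hΨ0 : HasZeroMean Ψ := pattern_hasZeroMean hm n
  have hΨ1 : ∀ x, ‖Ψ x‖ ≤ 1 := norm_pattern_le_one m n
  -- constants
  have hn' : (0 : ℝ) < (n : ℝ) := Nat.cast_pos.2 hn
  set κ2 : ℝ := (2 * Real.pi) ^ 2 * ((m : ℝ) ^ 2 + (n : ℝ) ^ 2) with hκ2def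
  have hκ2 : 0 < κ2 := by rw [hκ2def]; positivity
  set c : ℝ := V * (2 * Real.pi * n) / F with hcdef
  have hc : 0 < c := by rw [hcdef]; positivity
  have hδ : 0 < κ2 / (4 * Real.pi ^ 2 * c) := by positivity
  -- the identity, solved for `−Λ⟨T_s⟩`
  have hid : ∀ j, -Λ.longTimeAvg (fun t => ∫ x, ⟪u j t x - V • EuclideanSpace.single (2 : Fin 3) (1 : ℝ),
        convect (fun y => u j t y - V • EuclideanSpace.single (2 : Fin 3) (1 : ℝ)) Ψ x⟫) =
      c * Λ.longTimeAvg (fun t => ∫ x, ⟪f x, u j t x⟫) -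
        ν j * κ2 * Λ.longTimeAvg (fun t => ∫ x, ⟪Ψ x, u j t x⟫) := by
    intro j
    have h := dopplerWorkIdentity_proof Λ F V (ν j) m n (u₀ j) (u j) hV (hν j) hn (hLH j) (hmom j) (hsup j)
    have hFne : F ≠ 0 := hF.ne'
    have hVne : V * (2 * Real.pi * n) ≠ 0 := by positivity
    rw [hcdef, h]
    field_simp
    ring
  -- the clock-term bound at `δ = κ²/(4π²c)`
  have hB : ∀ j, Λ.longTimeAvg (fun t => ∫ x, ⟪Ψ x, u j t x⟫) ≤
      κ2 / (4 * Real.pi ^ 2 * c) / 2 +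
        1 ^ 2 / (8 * Real.pi ^ 2 * ν j * (κ2 / (4 * Real.pi ^ 2 * c))) *
          Λ.longTimeAvg (fun t => ∫ x, ⟪f x, u j t x⟫) :=
    fun j => longTimeAvg_inner_le Λ (hν j) hfS hf0 (hLH j) (hsup j) hΨc hΨ0 hΨ1 hδ
  -- choose the tail: `ν_j κ⁴/(8π²c) ≤ cη/4` for `j ≥ J`
  obtain ⟨J, hJ⟩ : ∃ J : ℕ, ∀ j ≥ J, ν j ≤ c * η / 4 / (κ2 ^ 2 / (8 * Real.pi ^ 2 * c) + 1) := by
    have hpos : 0 < c * η / 4 / (κ2 ^ 2 / (8 * Real.pi ^ 2 * c) + 1) := by positivity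
    exact eventually_atTop.1 ((hν0.eventually (ge_mem_nhds hpos)).mono fun j hj => hj)
  have hfloorTail : ∀ j, J ≤ j →
      c * η / 4 ≤ -Λ.longTimeAvg (fun t => ∫ x, ⟪u j t x - V • EuclideanSpace.single (2 : Fin 3) (1 : ℝ),
        convect (fun y => u j t y - V • EuclideanSpace.single (2 : Fin 3) (1 : ℝ)) Ψ x⟫) := by
    intro j hj
    have hsmall : ν j * (κ2 ^ 2 / (8 * Real.pi ^ 2 * c)) ≤ c * η / 4 := by
      have h1 : ν j * (κ2 ^ 2 / (8 * Real.pi ^ 2 * c) + 1) ≤ c * η / 4 := by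
        have := hJ j hj
        rwa [le_div_iff₀ (by positivity)] at this
      nlinarith [(hν j).le, h1]
    exact floor_arith hc (hν j) hκ2 (hid j) (hinj j) (hB j) hsmall
  -- assemble the crux along the reindexed tail `j ↦ j + J`
  refine ⟨F, V, m, n, hF, hV, hm, hn, Λ, fun j => ν (j + J), fun j => u₀ (j + J), fun j => u (j + J),
    fun j => hν _, hν0.comp (tendsto_add_atTop_nat J), fun j => hLH _, fun j => hmom _, fun j => hsup _,
    fun j => hnoleak _, c * η / 4, by positivity, fun j => ?_⟩
  exact hfloorTail (j + J) (Nat.le_add_left J j)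

/-- **`QuadratureStressFloor` ⟺ the energy-free, no-leak, pinned-momentum injection floor in one generalized
limit.** The kernel-precise content of crux C1: no energy normalisation (per-`j` bounds only), no regularity or
periodicity of the witnesses, and the quadrature stress `T_s` eliminated — what remains is the mean INJECTION
floor `η ≤ Λ⟨(f,u_j)⟩` along a no-leak drift-`V` Leray–Hopf family of the Doppler force as `ν_j → 0`
(`stub_bridgeEnergyFreeInjectionFloor` and `dopplerClock_injectionFloor_of_quadratureStressFloor`). [folklore] -/
theorem dopplerClock_quadratureStressFloor_iff_energyFreeInjectionFloor :
    Summit.AnomalousDissipation.AnomalousDissipation.Theses.DopplerClock.QuadratureStressFloor ↔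
    (∃ (F V : ℝ) (m n : ℕ), 0 < F ∧ 0 < V ∧ 0 < m ∧ 0 < n ∧
      ∃ (Λ : Literature.Analysis.FluidPDE.GeneralizedLimit),
      ∃ (ν : ℕ → ℝ) (u₀ : ℕ → UnitAddTorus (Fin 3) → EuclideanSpace ℝ (Fin 3))
        (u : ℕ → ℝ → UnitAddTorus (Fin 3) → EuclideanSpace ℝ (Fin 3)),
        (∀ j, 0 < ν j) ∧ Filter.Tendsto ν Filter.atTop (nhds 0) ∧
        (∀ j, Literature.Analysis.FluidPDE.Torus.IsGlobalLerayHopf (ν j) (fun _ => (fun (x : UnitAddTorus (Fin 3)) => (F * (UnitAddTorus.mFourier (Pi.single (1 : Fin 3) (m : ℤ)) x).im * (UnitAddTorus.mFourier (Pi.single (2 : Fin 3) (n : ℤ)) x).re) • EuclideanSpace.single (0 : Fin 3) (1 : ℝ))) (u₀ j) (u j)) ∧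
        (∀ j, ∫ x, u₀ j x = V • EuclideanSpace.single (2 : Fin 3) (1 : ℝ)) ∧
        (∀ j, ∃ C : ℝ, ∀ t : ℝ, 0 ≤ t → Literature.Analysis.FunctionSpaces.Torus.kineticEnergy (u j t) ≤ C) ∧
        (∀ j, Literature.Analysis.FluidPDE.longTimeAvgSup (fun t => ∫ x, inner ℝ ((F * (UnitAddTorus.mFourier (Pi.single (1 : Fin 3) (m : ℤ)) x).im * (UnitAddTorus.mFourier (Pi.single (2 : Fin 3) (n : ℤ)) x).re) • EuclideanSpace.single (0 : Fin 3) (1 : ℝ)) (u j t x)) ≤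
          Literature.Analysis.FluidPDE.meanDissipation (ν j) (u j)) ∧
        ∃ η : ℝ, 0 < η ∧ ∀ j, η ≤ Λ.longTimeAvg (fun t => ∫ x, inner ℝ ((F * (UnitAddTorus.mFourier (Pi.single (1 : Fin 3) (m : ℤ)) x).im * (UnitAddTorus.mFourier (Pi.single (2 : Fin 3) (n : ℤ)) x).re) • EuclideanSpace.single (0 : Fin 3) (1 : ℝ)) (u j t x))) :=
  ⟨dopplerClock_injectionFloor_of_quadratureStressFloor, dopplerClock_quadratureStressFloor_of_energyFreeInjectionFloor⟩

/-- **Registered stub `stub_bridgeEnergyFreeInjectionFloor` of line `Sketch` (crux `QuadratureStressFloor`,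
stmt-AnomalousDissipation-18129): the ENERGY-FREE bridge, verbatim registered signature.** A no-leak drift-`V`
Leray–Hopf family of the Doppler force with PER-`j` energy bounds and an injection floor in one generalized limit
gives the crux (its unfolded body). Proof: `dopplerClock_quadratureStressFloor_of_energyFreeInjectionFloor`. [folklore] -/
theorem stub_bridgeEnergyFreeInjectionFloor :
    (∃ (F V : ℝ) (m n : ℕ), 0 < F ∧ 0 < V ∧ 0 < m ∧ 0 < n ∧
      ∃ (Λ : Literature.Analysis.FluidPDE.GeneralizedLimit),
      ∃ (ν : ℕ → ℝ) (u₀ : ℕ → UnitAddTorus (Fin 3) → EuclideanSpace ℝ (Fin 3))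
        (u : ℕ → ℝ → UnitAddTorus (Fin 3) → EuclideanSpace ℝ (Fin 3)),
        (∀ j, 0 < ν j) ∧ Filter.Tendsto ν Filter.atTop (nhds 0) ∧
        (∀ j, Literature.Analysis.FluidPDE.Torus.IsGlobalLerayHopf (ν j) (fun _ => (fun (x : UnitAddTorus (Fin 3)) => (F * (UnitAddTorus.mFourier (Pi.single (1 : Fin 3) (m : ℤ)) x).im * (UnitAddTorus.mFourier (Pi.single (2 : Fin 3) (n : ℤ)) x).re) • EuclideanSpace.single (0 : Fin 3) (1 : ℝ))) (u₀ j) (u j)) ∧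
        (∀ j, ∫ x, u₀ j x = V • EuclideanSpace.single (2 : Fin 3) (1 : ℝ)) ∧
        (∀ j, ∃ C : ℝ, ∀ t : ℝ, 0 ≤ t → Literature.Analysis.FunctionSpaces.Torus.kineticEnergy (u j t) ≤ C) ∧
        (∀ j, Literature.Analysis.FluidPDE.longTimeAvgSup (fun t => ∫ x, inner ℝ ((F * (UnitAddTorus.mFourier (Pi.single (1 : Fin 3) (m : ℤ)) x).im * (UnitAddTorus.mFourier (Pi.single (2 : Fin 3) (n : ℤ)) x).re) • EuclideanSpace.single (0 : Fin 3) (1 : ℝ)) (u j t x)) ≤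
          Literature.Analysis.FluidPDE.meanDissipation (ν j) (u j)) ∧
        ∃ η : ℝ, 0 < η ∧ ∀ j, η ≤ Λ.longTimeAvg (fun t => ∫ x, inner ℝ ((F * (UnitAddTorus.mFourier (Pi.single (1 : Fin 3) (m : ℤ)) x).im * (UnitAddTorus.mFourier (Pi.single (2 : Fin 3) (n : ℤ)) x).re) • EuclideanSpace.single (0 : Fin 3) (1 : ℝ)) (u j t x))) →
    (∃ (F V : ℝ) (m n : ℕ), 0 < F ∧ 0 < V ∧ 0 < m ∧ 0 < n ∧ ∃ (Λ : Literature.Analysis.FluidPDE.GeneralizedLimit), ∃ (ν : ℕ → ℝ) (u₀ : ℕ → UnitAddTorus (Fin 3) → EuclideanSpace ℝ (Fin 3)) (u : ℕ → ℝ → UnitAddTorus (Fin 3) → EuclideanSpace ℝ (Fin 3)), (∀ j, 0 < ν j) ∧ Filter.Tendsto ν Filter.atTop (nhds 0) ∧ (∀ j, Literature.Analysis.FluidPDE.Torus.IsGlobalLerayHopf (ν j) (fun _ => (fun (x : UnitAddTorus (Fin 3)) => (F * (UnitAddTorus.mFourier (Pi.single (1 : Fin 3) (m : ℤ)) x).im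 * (UnitAddTorus.mFourier (Pi.single (2 : Fin 3) (n : ℤ)) x).re) • EuclideanSpace.single (0 : Fin 3) (1 : ℝ))) (u₀ j) (u j)) ∧ (∀ j, ∫ x, u₀ j x = V • EuclideanSpace.single (2 : Fin 3) (1 : ℝ)) ∧ (∀ j, ∃ C : ℝ, ∀ t : ℝ, 0 ≤ t → Literature.Analysis.FunctionSpaces.Torus.kineticEnergy (u j t) ≤ C) ∧ (∀ j, Literature.Analysis.FluidPDE.longTimeAvgSup (fun t => ∫ x, inner ℝ ((F * (UnitAddTorus.mFourier (Pi.single (1 : Fin 3) (m : ℤ)) x).im * (UnitAddTorus.mFourier (Pi.single (2 : Fin 3) (n : ℤ)) x).re) • EuclideanSpace.single (0 : Fin 3) (1 : ℝ)) (u j t x)) ≤ Literature.Analysis.FluidPDE.meanDissipation (ν j) (u j)) ∧ ∃ ε₀ : ℝ, 0 < ε₀ ∧ ∀ j, ε₀ ≤ -Λ.longTimeAvg (fun t => ∫ x, inner ℝ (u j t x - V • EuclideanSpace.single (2 : Fin 3) (1 : ℝ)) (Literature.Analysis.FunctionSpaces.Torus.convect (fun y => u j t y - V • EuclideanSpace.single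 (2 : Fin 3) (1 : ℝ)) (fun (y : UnitAddTorus (Fin 3)) => ((UnitAddTorus.mFourier (Pi.single (1 : Fin 3) (m : ℤ)) y).im * (UnitAddTorus.mFourier (Pi.single (2 : Fin 3) (n : ℤ)) y).im) • EuclideanSpace.single (0 : Fin 3) (1 : ℝ)) x))) :=
  dopplerClock_quadratureStressFloor_of_energyFreeInjectionFloor

end Summit.AnomalousDissipation.AnomalousDissipation.Theorems

end
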